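import Summits.CriticalPhenomena.CardyFormulaZ2.Theses.CardyObliqueExplorer
import Literature.Probability.RandomPlanarGeometry.ConformalRectangleProofs

/-!
# Strategist r1 census artefact — `ExplorationHitCardy` (stmt-CriticalPhenomena-11249) and its
# only decomposition are the summit in costume

Route `CardyObliqueExplorer` (route-CriticalPhenomena-CardyObliqueExplorer), sub-problem
`CardyFormulaZ2`. All theorems below are sorry-free, pure filter algebra over the route's own
decls; they are the "theorem showing the crux is the summit in costume" required by the
REDIRECT STRATEGIST instruction (3), at two levels:

* `explorationHitCardy_iff_summit` — GLOBAL: modulo the two dictionary items of the certified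
  `closes` (`DiscretisationExists`, `CrossingHitDictionary`, both believed true, difficulty M),
  the crux `X = ExplorationHitCardy` is EQUIVALENT to the conjunct `CardyFormulaZ2` (re-proves the
  refuter's `Attack.iff_cardy`, evidence Scratch.lean of 2026-08-15T17:12Z, inside this census).
* `tbAt_iff_hitAt`, `oiAt_iff_hitAt` — POINTWISE in `(R, E)`: the route's foreseen / registered
  split `X ⇐ DoobIdentity ∧ ObliqueInvariance ∧ TipBalance` (skeleton `Lines/birth.lean`) is ONE
  linear relation `P = u₀ + S/2 + o(1)` (DoobIdentity) between the hitting probability `P`, the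
  oblique-walk absorption probability `u₀` and the tip-balance sum `S`; hence for EACH conformal
  rectangle `R` and EACH discretising family `E` separately, given the Doob relation at `(R, E)`,
  `TipBalance(R,E) ↔ HitCardy(R,E)` once `ObliqueInvariance(R,E)` holds, and
  `ObliqueInvariance(R,E) ↔ HitCardy(R,E)` once `TipBalance(R,E)` holds. So neither crux of the
  split has a special case (a domain, a family, a regime) that is not the same special case of the
  hitting-Cardy statement itself: no BC5 rung of `TipBalance` can exist outside the regime where
  Cardy's value is already known for the hitting event.
* `tipBalance_iff_explorationHitCardy`, `tipBalance_iff_summit` — the global corollaries over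
  the route decls by name: `DoobIdentity → ObliqueInvariance → (TipBalance ↔ ExplorationHitCardy)`
  and `… → DiscretisationExists → CrossingHitDictionary → (TipBalance ↔ CardyFormulaZ2)`.

The converse directions use only `MarkedDomain.exists_isUniformizing_holds` (PROVED in the tree:
every conformal rectangle has a uniformizing datum), to instantiate `HasCrossingLimit`.
-/

namespace Summit.CriticalPhenomena.CardyFormulaZ2.Cruxes.ExplorationHitCardy.Costume

open Summit.CriticalPhenomena.CardyFormulaZ2.Theses.CardyObliqueExplorer
open Filter Topology
open Literature.Probability.RandomPlanarGeometry (ConformalRectangle cardyFunction)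
open Literature.Probability.LatticeModels (DiscreteDobrushin)

/-! ### 1. Global: the crux is the conjunct modulo the dictionary -/

/-- **X ↔ S modulo the dictionary.** Given the two dictionary items of the certified deciding
theorem, `ExplorationHitCardy ↔ CardyFormulaZ2`. (→) is the route's `closes`; (←) subtracts the
`o(1)` crossing/hitting difference from the crossing limit, family by family. -/
theorem explorationHitCardy_iff_summit (hD : DiscretisationExists) (hC : CrossingHitDictionary) :
    ExplorationHitCardy ↔ _root_.CardyFormulaZ2 := by
  constructor
  · intro hX
    exact closes hD hX hC
  · intro hS R E hE hA hB hM hadm φ x hφx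
    have h1 := hS R φ x hφx
    have h2 := hC R E hE hA hB hM hadm
    have h := h1.sub h2
    rw [sub_zero] at h
    refine h.congr' (Eventually.of_forall fun δ => ?_)
    simp only [sub_sub_cancel]

/-- The converse direction alone needs only the dictionary at the given family (no
`DiscretisationExists`): `CardyFormulaZ2 → CrossingHitDictionary → ExplorationHitCardy`. -/
theorem explorationHitCardy_of_summit (hC : CrossingHitDictionary) (hS : _root_.CardyFormulaZ2) :
    ExplorationHitCardy := by
  intro R E hE hA hB hM hadm φ x hφx
  have h := (hS R φ x hφx).sub (hC R E hE hA hB hM hadm)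
  rw [sub_zero] at h
  refine h.congr' (Eventually.of_forall fun δ => ?_)
  simp only [sub_sub_cancel]

/-! ### 2. Pointwise in `(R, E)`: the split is one linear relation with two unknowns -/

section Pointwise

variable (R : ConformalRectangle) (E : ℝ → DiscreteDobrushin)

/-- The `P_{1/2}`-probability that the `a → c` medial exploration of `E δ` examines a `(cd)_δ`-edge
before any `(bc)_δ`-edge (the event of `ExplorationHitCardy`, verbatim). -/
noncomputable def hitProb (δ : ℝ) : ℝ :=
  (Literature.Probability.Percolation.bondPercolation (Literature.Probability.LatticeModels.zdGraph 2) Literature.Probability.Percolation.half).real {cfg | let l := Literature.Probability.LatticeModels.medialExploration (E δ) cfg; let l' := (if (∀ e₀ ∈ l.head?, dist (Literature.Probability.LatticeModels.medialPoint δ e₀) (R.pt 0) ≤ dist (Literature.Probability.LatticeModels.medialPoint δ e₀) (R.pt 2)) then l else l.reverse); ∃ n : ℕ, ∃ e ∈ l'[n]?, (∃ v ∈ e, v ∈ (E δ).zdDiscreteArc (R.arc 2)) ∧ ∀ m < n, ∀ e' ∈ l'[m]?, ∀ v ∈ e', v ∉ (E δ).zdDiscreteArc (R.arc 1)}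

/-- The oblique medial walk's absorption probability at `b`, started from the `(cd)_δ`-cell
nearest `c`, in the unrevealed discrete domain (landed D1). -/
noncomputable def u0 (δ : ℝ) : ℝ :=
  Literature.Probability.LatticeModels.obliqueMedialAbsorb R (E δ) ∅ [] (Literature.Probability.LatticeModels.obliqueMedialCCell R (E δ))

/-- The tip-balance sum along the exploration of `E δ` (landed D2). -/
noncomputable def tbs (δ : ℝ) : ℝ :=
  Literature.Probability.Percolation.tipBalanceSum R (E δ)

/-- `DoobIdentity` at the family `(R, E)` (its conclusion, verbatim up to the abbreviations). -/
def DoobAt : Prop :=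
  Tendsto (fun δ => hitProb R E δ - u0 R E δ - tbs R E δ / 2) (𝓝[>] 0) (𝓝 0)

/-- `ObliqueInvariance` at `(R, E)`. -/
def OIAt : Prop := R.HasCrossingLimit (u0 R E) cardyFunction

/-- `TipBalance` at `(R, E)`. -/
def TBAt : Prop := Tendsto (tbs R E) (𝓝[>] 0) (𝓝 0)

/-- `ExplorationHitCardy` at `(R, E)`. -/
def HitAt : Prop := R.HasCrossingLimit (hitProb R E) cardyFunction

variable {R E}

/-- **TipBalance is the hitting-Cardy statement in costume, family by family.** Given the Doob
relation and oblique invariance at `(R, E)`: `TipBalance(R,E) ↔ HitCardy(R,E)`. -/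
theorem tbAt_iff_hitAt (hD : DoobAt R E) (hO : OIAt R E) : TBAt R E ↔ HitAt R E := by
  constructor
  · intro hT φ x hφx
    have h := (hD.add (hO φ x hφx)).add ((show Tendsto (tbs R E) _ _ from hT).div_const 2)
    rw [zero_add, zero_div, add_zero] at h
    refine h.congr' (Eventually.of_forall fun δ => ?_)
    simp only [hitProb, u0, tbs]
    ring
  · intro hH
    obtain ⟨φ, x, hφx⟩ :=
      Literature.Probability.RandomPlanarGeometry.MarkedDomain.exists_isUniformizing_holds (n := 4) R
    have h := (((hH φ x hφx).sub (hO φ x hφx)).sub hD).const_mul 2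
    rw [sub_self, sub_zero, mul_zero] at h
    refine h.congr' (Eventually.of_forall fun δ => ?_)
    simp only [hitProb, u0, tbs]
    ring

/-- **Symmetrically, ObliqueInvariance is the hitting-Cardy statement in costume, family by family,**
once tip balance holds at `(R, E)`. -/
theorem oiAt_iff_hitAt (hD : DoobAt R E) (hT : TBAt R E) : OIAt R E ↔ HitAt R E := by
  constructor
  · intro hO
    exact (tbAt_iff_hitAt hD hO).1 hT
  · intro hH φ x hφx
    have h := ((hH φ x hφx).sub hD).sub ((show Tendsto (tbs R E) _ _ from hT).div_const 2)
    rw [sub_zero, zero_div, sub_zero] at h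
    refine h.congr' (Eventually.of_forall fun δ => ?_)
    simp only [hitProb, u0, tbs]
    ring

/-- And the Doob relation itself is forced once the other two limits and the hitting limit hold:
the three pieces and the crux satisfy exactly one linear relation. -/
theorem doobAt_of (hO : OIAt R E) (hT : TBAt R E) (hH : HitAt R E) : DoobAt R E := by
  obtain ⟨φ, x, hφx⟩ :=
    Literature.Probability.RandomPlanarGeometry.MarkedDomain.exists_isUniformizing_holds (n := 4) R
  have h := ((hH φ x hφx).sub (hO φ x hφx)).sub ((show Tendsto (tbs R E) _ _ from hT).div_const 2)
  rw [sub_self, zero_div, sub_zero] at h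
  exact h

end Pointwise

/-! ### 3. The global corollaries over the route decls, by name -/

/-- The route items are the pointwise statements under the common hypothesis block (by `rfl`). -/
theorem doobIdentity_iff : DoobIdentity ↔ ∀ (R : ConformalRectangle) (E : ℝ → DiscreteDobrushin), (∀ δ, (E δ).Ω = R.carrier ∧ (E δ).δ = δ) → Filter.Tendsto (fun δ => Metric.hausdorffEDist (E δ).arcA ((R.chord 0 2 (by decide)).arc 0)) (nhdsWithin 0 (Set.Ioi 0)) (nhds 0) → Filter.Tendsto (fun δ => Metric.hausdorffEDist (E δ).arcB ((R.chord 0 2 (by decide)).arc 1)) (nhdsWithin 0 (Set.Ioi 0)) (nhds 0) → Filter.Tendsto (fun δ => Metric.hausdorffEDist (Literature.Probability.LatticeModels.medialPoint δ '' (E δ).zdABEdges) {R.pt 0, R.pt 2}) (nhdsWithin 0 (Set.Ioi 0)) (nhds 0) → (∀ᶠ δ in nhdsWithin (0:ℝ) (Set.Ioi 0), (E δ).IsZdAdmissible) → DoobAt R E :=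
  Iff.rfl

theorem obliqueInvariance_iff : ObliqueInvariance ↔ ∀ (R : ConformalRectangle) (E : ℝ → DiscreteDobrushin), (∀ δ, (E δ).Ω = R.carrier ∧ (E δ).δ = δ) → Filter.Tendsto (fun δ => Metric.hausdorffEDist (E δ).arcA ((R.chord 0 2 (by decide)).arc 0)) (nhdsWithin 0 (Set.Ioi 0)) (nhds 0) → Filter.Tendsto (fun δ => Metric.hausdorffEDist (E δ).arcB ((R.chord 0 2 (by decide)).arc 1)) (nhdsWithin 0 (Set.Ioi 0)) (nhds 0) → Filter.Tendsto (fun δ => Metric.hausdorffEDist (Literature.Probability.LatticeModels.medialPoint δ '' (E δ).zdABEdges) {R.pt 0, R.pt 2}) (nhdsWithin 0 (Set.Ioi 0)) (nhds 0) → (∀ᶠ δ in nhdsWithin (0:ℝ) (Set.Ioi 0), (E δ).IsZdAdmissible) → OIAt R E :=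
  Iff.rfl

theorem tipBalance_iff : TipBalance ↔ ∀ (R : ConformalRectangle) (E : ℝ → DiscreteDobrushin), (∀ δ, (E δ).Ω = R.carrier ∧ (E δ).δ = δ) → Filter.Tendsto (fun δ => Metric.hausdorffEDist (E δ).arcA ((R.chord 0 2 (by decide)).arc 0)) (nhdsWithin 0 (Set.Ioi 0)) (nhds 0) → Filter.Tendsto (fun δ => Metric.hausdorffEDist (E δ).arcB ((R.chord 0 2 (by decide)).arc 1)) (nhdsWithin 0 (Set.Ioi 0)) (nhds 0) → Filter.Tendsto (fun δ => Metric.hausdorffEDist (Literature.Probability.LatticeModels.medialPoint δ '' (E δ).zdABEdges) {R.pt 0, R.pt 2}) (nhdsWithin 0 (Set.Ioi 0)) (nhds 0) → (∀ᶠ δ in nhdsWithin (0:ℝ) (Set.Ioi 0), (E δ).IsZdAdmissible) → TBAt R E :=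
  Iff.rfl

theorem explorationHitCardy_iff : ExplorationHitCardy ↔ ∀ (R : ConformalRectangle) (E : ℝ → DiscreteDobrushin), (∀ δ, (E δ).Ω = R.carrier ∧ (E δ).δ = δ) → Filter.Tendsto (fun δ => Metric.hausdorffEDist (E δ).arcA ((R.chord 0 2 (by decide)).arc 0)) (nhdsWithin 0 (Set.Ioi 0)) (nhds 0) → Filter.Tendsto (fun δ => Metric.hausdorffEDist (E δ).arcB ((R.chord 0 2 (by decide)).arc 1)) (nhdsWithin 0 (Set.Ioi 0)) (nhds 0) → Filter.Tendsto (fun δ => Metric.hausdorffEDist (Literature.Probability.LatticeModels.medialPoint δ '' (E δ).zdABEdges) {R.pt 0, R.pt 2}) (nhdsWithin 0 (Set.Ioi 0)) (nhds 0) → (∀ᶠ δ in nhdsWithin (0:ℝ) (Set.Ioi 0), (E δ).IsZdAdmissible) → HitAt R E :=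
  Iff.rfl

/-- **`DoobIdentity → ObliqueInvariance → (TipBalance ↔ ExplorationHitCardy)`**: given the support
`DoobIdentity` and the crux `ObliqueInvariance`, the rank-2 crux `TipBalance` IS the crux `X`. -/
theorem tipBalance_iff_explorationHitCardy (hD : DoobIdentity) (hO : ObliqueInvariance) :
    TipBalance ↔ ExplorationHitCardy := by
  rw [tipBalance_iff, explorationHitCardy_iff]
  rw [doobIdentity_iff] at hD
  rw [obliqueInvariance_iff] at hO
  constructor
  · intro hT R E hE hA hB hM hadm
    exact (tbAt_iff_hitAt (hD R E hE hA hB hM hadm) (hO R E hE hA hB hM hadm)).1 (hT R E hE hA hB hM hadm)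
  · intro hH R E hE hA hB hM hadm
    exact (tbAt_iff_hitAt (hD R E hE hA hB hM hadm) (hO R E hE hA hB hM hadm)).2 (hH R E hE hA hB hM hadm)

/-- **`DoobIdentity → TipBalance → (ObliqueInvariance ↔ ExplorationHitCardy)`**: symmetrically. -/
theorem obliqueInvariance_iff_explorationHitCardy (hD : DoobIdentity) (hT : TipBalance) :
    ObliqueInvariance ↔ ExplorationHitCardy := by
  rw [obliqueInvariance_iff, explorationHitCardy_iff]
  rw [doobIdentity_iff] at hD
  rw [tipBalance_iff] at hT
  constructor
  · intro hO R E hE hA hB hM hadm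
    exact (oiAt_iff_hitAt (hD R E hE hA hB hM hadm) (hT R E hE hA hB hM hadm)).1 (hO R E hE hA hB hM hadm)
  · intro hH R E hE hA hB hM hadm
    exact (oiAt_iff_hitAt (hD R E hE hA hB hM hadm) (hT R E hE hA hB hM hadm)).2 (hH R E hE hA hB hM hadm)

/-- **TipBalance ↔ CardyFormulaZ2** modulo the four other items of the route
(`DoobIdentity`, `ObliqueInvariance`, `DiscretisationExists`, `CrossingHitDictionary`): the
rank-2 crux of the only decomposition is the summit conjunct in costume. -/
theorem tipBalance_iff_summit (hD : DoobIdentity) (hO : ObliqueInvariance)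
    (hE : DiscretisationExists) (hC : CrossingHitDictionary) :
    TipBalance ↔ _root_.CardyFormulaZ2 :=
  (tipBalance_iff_explorationHitCardy hD hO).trans (explorationHitCardy_iff_summit hE hC)

end Summit.CriticalPhenomena.CardyFormulaZ2.Cruxes.ExplorationHitCardy.Costume
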